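import Mathlib
import HarnessLib
import Literature.MathematicalPhysics.StatisticalMechanics.TorusBlocks

/-!
# Partial blocks in a box: `#(B ∩ (x + [−r,r]^d)) ≥ min(s, r+1−dist_∞(x,B))^d`
# (geometry of Adams–Buchholz–Kotecký–Müller Lemma 7.6 (ii), (7.62))

[ABKM19] (7.62) compares the added form `δ_{k+1}M_{k+1}^U` of a `(k+1)`-polymer `U` with the
strong form of the enlarged set `U⁺` at the PREVIOUS scale; with box-density indicators
(`WeightDataGeometry.lean`) this needs a lower bound for the density `χ_{k+1}^U` slightly OUTSIDE
`U⁺`, where the box `x + [−2L^{k+1}, 2L^{k+1}]^d` no longer contains a whole block of `U` but still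
at least half of one in every direction.  This file proves the underlying count on the torus
`(ℤ/M)^d`, `M = s·t`, `s,t` odd: if `u ∈ B` (a block of side `s`), `|x − u|_∞ ≤ D ≤ r`, then
`#(B ∩ (x + [−r,r]^d)) ≥ (min(s, r + 1 − D))^d`.

* `min_le_toNat_sub` (the one-dimensional integer-interval count);
* `min_le_card_fibre_inter` (one coordinate on `ℤ/M`, through symmetric representatives and a
  shift by a multiple of `M` to undo the wrap-around);
* **`pow_min_le_card_blockOf_inter_ball`** (the product over coordinates).

Everything is proved; no named fact.

## References
* S. Adams, S. Buchholz, R. Kotecký, S. Müller, arXiv:1910.13564, Lemma 7.6 (ii) (7.62), Ch. 6.2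
  [AdamsBuchholzKoteckyMuller2019].
* S. Adams, R. Kotecký, S. Müller, arXiv:1606.09541, Ch. 4 (blocks) [AdamsKoteckyMuller2016].
-/

namespace Literature.MathematicalPhysics.StatisticalMechanics.TorusPolymer

open Finset
open Literature.MathematicalPhysics.StatisticalMechanics.GradientFRD
  (supNorm natAbs_valMinAbs_le_supNorm natAbs_valMinAbs_intCast_le)

variable {d M : ℕ}

/-! ## One dimension: integer intervals -/

/-- **Integer-interval count**: for `υ ∈ [c−h, c+h]`, `|ξ − υ| ≤ D ≤ r`, the interval
`[c−h, c+h] ∩ [ξ−r, ξ+r]` has at least `min(2h+1, r+1−D)` points.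
[cite: AdamsBuchholzKoteckyMuller2019, Lemma 7.6 (ii) (7.62)] -/
theorem min_le_toNat_sub {c h ξ υ r D : ℤ} (hh : 0 ≤ h) (hυ : c - h ≤ υ ∧ υ ≤ c + h)
    (hξυ : |ξ - υ| ≤ D) (hDr : D ≤ r) :
    min (2 * h + 1) (r + 1 - D) ≤
      ((min (c + h) (ξ + r) + 1 - max (c - h) (ξ - r)).toNat : ℤ) := by
  rw [abs_le] at hξυ
  have hD : 0 ≤ D := by linarith [abs_nonneg (ξ - υ), abs_le.2 hξυ]
  rw [Int.toNat_of_nonneg (by omega)]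
  omega

/-! ## One coordinate on the torus -/

variable [NeZero M]

/-- On `ℤ/M` two integers at distance `< M` with the same residue are equal.
[cite: AdamsKoteckyMuller2016, Ch. 4] -/
theorem intCast_injOn_of_sub_lt {a b : ℤ} (hab : |a - b| < M) (h : (a : ZMod M) = (b : ZMod M)) :
    a = b := by
  rw [ZMod.intCast_eq_intCast_iff_dvd_sub] at h
  obtain ⟨q, hq⟩ := h
  rw [abs_lt] at hab
  have hM : (0 : ℤ) < M := by exact_mod_cast Nat.pos_of_ne_zero (NeZero.ne M)
  have hq0 : q = 0 := by
    by_contra hq0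
    rcases lt_or_gt_of_ne hq0 with hneg | hpos
    · have : (M : ℤ) * q ≤ -M := by nlinarith
      omega
    · have : (M : ℤ) ≤ M * q := by nlinarith
      omega
  rw [hq0, mul_zero, sub_eq_zero] at hq
  exact hq.symm

/-- **One coordinate**: for `M = s·t` (`s,t` odd), residues `u, x` with `|x − u| ≤ D ≤ r`, the residues
in the block-index fibre of `u` within distance `r` of `x` number at least `min(s, r+1−D)`.
[cite: AdamsBuchholzKoteckyMuller2019, Lemma 7.6 (ii) (7.62)] -/
theorem min_le_card_fibre_inter {s t : ℕ} (hM : M = s * t) (hs : Odd s) (ht : Odd t)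
    (u x : ZMod M) {D r : ℕ} (hux : (x - u).valMinAbs.natAbs ≤ D) (hDr : D ≤ r) :
    min s (r + 1 - D) ≤
      (univ.filter fun v : ZMod M =>
        resIndex s v = resIndex s u ∧ (v - x).valMinAbs.natAbs ≤ r).card := by
  classical
  set b := resIndex s u with hb
  have hbabs := abs_resIndex_le hM hs ht u
  have hυJ := (resIndex_eq_iff hs u b).1 rfl
  obtain ⟨h, hs'⟩ := hs
  obtain ⟨t', ht''⟩ := ht
  have hh : (((s : ℕ) : ℤ) - 1) / 2 = h := by rw [hs']; push_cast; omega
  have ht' : (((t : ℕ) : ℤ) - 1) / 2 = t' := by rw [ht'']; push_cast; omega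
  have hMeq : ((M : ℕ) : ℤ) = 2 * (2 * h * t' + h + t') + 1 := by rw [hM, hs', ht'']; push_cast; ring
  have hM' : (((M : ℕ) : ℤ) - 1) / 2 = 2 * h * t' + h + t' := by rw [hMeq]; omega
  rw [ht', abs_le] at hbabs
  rw [hh] at hυJ
  have hsb : (s : ℤ) * b = (2 * h + 1) * b := by rw [hs']; push_cast; ring
  rw [hsb] at hυJ
  have hlo : (2 * (h : ℤ) + 1) * (-t') ≤ (2 * h + 1) * b := mul_le_mul_of_nonneg_left hbabs.1 (by positivity)
  have hhi : (2 * (h : ℤ) + 1) * b ≤ (2 * h + 1) * t' := mul_le_mul_of_nonneg_left hbabs.2 (by positivity)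
  -- representatives and the wrap-around shift `q`
  set υ : ℤ := u.valMinAbs with hυ
  set ξ : ℤ := x.valMinAbs with hξ
  set δ : ℤ := (x - u).valMinAbs with hδ
  have hδD : |δ| ≤ D := by rw [Int.abs_eq_natAbs]; exact_mod_cast hux
  have hcast : ((ξ - υ : ℤ) : ZMod M) = (δ : ZMod M) := by
    push_cast; rw [hξ, hυ, hδ, ZMod.coe_valMinAbs, ZMod.coe_valMinAbs, ZMod.coe_valMinAbs]
  rw [ZMod.intCast_eq_intCast_iff_dvd_sub] at hcast
  obtain ⟨q, hq⟩ := hcast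
  -- the shifted interval `J' = [c' − h, c' + h]`, `c' = s b − q M`, contains `υ' = υ − qM = ξ − δ`
  set c' : ℤ := (2 * h + 1) * b - (M : ℤ) * q with hc'
  have hυ' : c' - h ≤ ξ - δ ∧ ξ - δ ≤ c' + h := by constructor <;> linarith [hυJ.1, hυJ.2]
  have hξδ : |ξ - (ξ - δ)| ≤ D := by rw [sub_sub_cancel]; exact hδD
  have hcount := min_le_toNat_sub (by positivity : (0 : ℤ) ≤ h) hυ' hξδ
    (show (D : ℤ) ≤ (r : ℤ) by exact_mod_cast hDr)
  -- the candidate set: the cast of `J' ∩ [ξ − r, ξ + r]`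
  set I := Finset.Icc (max (c' - h) (ξ - r)) (min (c' + h) (ξ + r)) with hI
  have hsub : I.image (fun z : ℤ => (z : ZMod M)) ⊆
      univ.filter fun v : ZMod M => resIndex s v = b ∧ (v - x).valMinAbs.natAbs ≤ r := by
    intro v hv
    obtain ⟨z, hz, rfl⟩ := Finset.mem_image.1 hv
    rw [hI, Finset.mem_Icc, max_le_iff, le_min_iff] at hz
    refine Finset.mem_filter.2 ⟨Finset.mem_univ _, ?_, ?_⟩
    · -- `z + qM ∈ J`, so its cast has representative `z + qM` and index `b`
      have hzJ : (2 * (h : ℤ) + 1) * b - h ≤ z + M * q ∧ z + M * q ≤ (2 * h + 1) * b + h := by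
        constructor <;> linarith [hz.1.1, hz.2.1]
      have habs : |z + M * q| ≤ (((M : ℕ) : ℤ) - 1) / 2 := by
        rw [hM', abs_le]; constructor <;> nlinarith [hzJ.1, hzJ.2]
      have hzc : ((z : ℤ) : ZMod M) = ((z + M * q : ℤ) : ZMod M) := by
        rw [ZMod.intCast_eq_intCast_iff_dvd_sub]; exact ⟨q, by ring⟩
      rw [hzc, resIndex_eq_iff ⟨h, hs'⟩, hh, hsb, valMinAbs_intCast_of_abs_le habs]
      exact hzJ
    · -- distance to `x`
      have hzx : ((z : ℤ) : ZMod M) - x = ((z - ξ : ℤ) : ZMod M) := by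
        push_cast; rw [hξ, ZMod.coe_valMinAbs]
      rw [hzx]
      refine (natAbs_valMinAbs_intCast_le (M := M) (z - ξ)).trans ?_
      have : |z - ξ| ≤ r := by rw [abs_le]; constructor <;> linarith [hz.1.2, hz.2.2]
      have := Int.abs_eq_natAbs (z - ξ) ▸ this
      exact_mod_cast this
  have hinj : Set.InjOn (fun z : ℤ => (z : ZMod M)) ↑I := by
    intro z hz z' hz' hzz
    rw [hI, Finset.coe_Icc, Set.mem_Icc, max_le_iff, le_min_iff] at hz hz'
    refine intCast_injOn_of_sub_lt ?_ hzz
    have hzz' : |z - z'| ≤ 2 * h := by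
      rw [abs_le]; constructor <;> linarith [hz.1.1, hz.2.1, hz'.1.1, hz'.2.1]
    have hP : (0 : ℤ) ≤ 2 * h * t' := by positivity
    calc |z - z'| ≤ 2 * h := hzz'
      _ < M := by rw [hMeq]; linarith
  calc min s (r + 1 - D) ≤ I.card := by
        have h1 : (I.card : ℤ) = ((min (c' + h) (ξ + r) + 1 - max (c' - h) (ξ - r)).toNat : ℤ) := by
          rw [hI, Int.card_Icc]
        have h2 : ((min s (r + 1 - D) : ℕ) : ℤ) ≤ min (2 * (h : ℤ) + 1) ((r : ℤ) + 1 - D) := by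
          have hsub : ((r + 1 - D : ℕ) : ℤ) = (r : ℤ) + 1 - D := by
            rw [Nat.cast_sub (by omega)]; push_cast; ring
          rw [Nat.cast_min, hsub, hs']; push_cast; exact le_rfl
        exact_mod_cast h2.trans (h1 ▸ hcount)
    _ = (I.image fun z : ℤ => (z : ZMod M)).card := (Finset.card_image_of_injOn hinj).symm
    _ ≤ _ := Finset.card_le_card hsub

/-! ## All coordinates -/

/-- **Partial block in a box**: for a block `B ∋ u` of side `s` (`M = s·t`, `s,t` odd) and a point
`x` with `|x − u|_∞ ≤ D ≤ r`: `#(B ∩ (x + [−r,r]^d)) ≥ (min(s, r+1−D))^d` (with `D ≤ r + 1 − s` the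
box contains the whole block, cf. `blockOf_subset_ball_of_near`).
[cite: AdamsBuchholzKoteckyMuller2019, Lemma 7.6 (ii) (7.62)] -/
theorem pow_min_le_card_blockOf_inter_ball {s t : ℕ} (hM : M = s * t) (hs : Odd s) (ht : Odd t)
    {u x : Fin d → ZMod M} {D r : ℕ} (hux : supNorm (x - u) ≤ D) (hDr : D ≤ r) :
    (min s (r + 1 - D)) ^ d ≤ (blockOf s u ∩ ball r x).card := by
  classical
  set S : Fin d → Finset (ZMod M) := fun i => univ.filter fun v : ZMod M =>
    resIndex s v = resIndex s (u i) ∧ (v - x i).valMinAbs.natAbs ≤ r with hS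
  have hsub : Fintype.piFinset S ⊆ blockOf s u ∩ ball r x := by
    intro y hy
    rw [Fintype.mem_piFinset] at hy
    have hy' : ∀ i, resIndex s (y i) = resIndex s (u i) ∧ (y i - x i).valMinAbs.natAbs ≤ r :=
      fun i => by simpa [hS] using hy i
    refine Finset.mem_inter.2 ⟨mem_blockOf.2 fun i => ?_, mem_ball.2 ?_⟩
    · rw [cubeIndex_eq_resIndex, cubeIndex_eq_resIndex]; exact (hy' i).1.symm
    · rw [TorusPolymer.supNorm_le_iff]; exact fun i => (hy' i).2
  refine le_trans ?_ (Finset.card_le_card hsub)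
  rw [Fintype.card_piFinset]
  have hc : (min s (r + 1 - D)) ^ d = ∏ _i : Fin d, min s (r + 1 - D) := by
    rw [Finset.prod_const, Finset.card_univ, Fintype.card_fin]
  rw [hc]
  refine Finset.prod_le_prod (fun i _ => Nat.zero_le _) fun i _ => ?_
  exact min_le_card_fibre_inter hM hs ht (u i) (x i)
    ((natAbs_valMinAbs_le_supNorm (x - u) i).trans hux) hDr

end Literature.MathematicalPhysics.StatisticalMechanics.TorusPolymer
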